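import Literature.AlgebraicGeometry.Frobenioids.IrreducibleMorphismsPreSteps
import Literature.AlgebraicGeometry.Frobenioids.FrobeniusTypePerfect
import Literature.AlgebraicGeometry.Frobenioids.EquivalenceTransport
import Literature.AlgebraicGeometry.Frobenioids.EquivalenceTransportAnchors
import Literature.AlgebraicGeometry.Frobenioids.EquivalencePreStepsQuasiIsotropic
import Literature.AlgebraicGeometry.Frobenioids.EquivalencePreStepsFSMType
import Literature.AlgebraicGeometry.Frobenioids.PreFrobenioidDataOfFunctor
import Literature.AlgebraicGeometry.Frobenioids.BaseCategoryTheoreticity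
import HarnessLib

/-!
# Frobenioids I, Theorem 3.4 (ii) AS PRINTED (2008 base hypothesis) for Frobenioids of PERFECT
# isotropic type: an equivalence preserves pre-steps, co-angular pre-steps and group-like objects

Mochizuki, *The geometry of Frobenioids I: the general theory*, Kyushu J. Math. **62** (2008)
293–400, Thm. 3.4 (ii), kurims p. 62, proof p. 63 ("follows formally from Proposition 1.14, (ii),
(iii)") [cite: MochizukiFrdI2008, Thm. 3.4 (ii) p.62]; Prop. 1.14 (i)–(iii), pp. 41–43
[cite: MochizukiFrdI2008, Prop. 1.14 p.41].

PROOF-ONLY file (seat abc-iut-w4-d093). State of the tree: the printed route to Thm. 3.4 (ii) rests on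
Prop. 1.14 (iii), whose printed "⟹" half fails (finding A8-F2 / F-t13-1: prime-Frobenius morphisms need
not be FSM-morphisms), so the cell proved (ii) over bases of FSM-type (abc-iut-L1-t13) and over bases of
FSMFF-type in the author's REVISED (2024) sense (abc-iut-L1-t11, `FrdI.isPreStep_map_of_isOfFSMFFType2024`);
the printed 2008 generality — bases of FSMFF-type as defined in §0 of the 2008 text, a STRICTLY larger
class (`Broom.exists_isOfFSMFFType_not_isOfFSMFFType2024`) — stayed open ("residual R2", GAP-LEDGER
G-L1d8-1). OBSERVATION proved here: for Frobenioids of PERFECT type, Prop. 1.14 (iii) is not needed at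
all. In a Frobenioid of perfect and isotropic type the divisor monoids `Φ(A)` are perfect
(Prop. 1.10 (iii), `PreFrobenioid.isPerfect_divisorMonoid`), hence have no irreducible elements, so by the
trichotomy of Prop. 1.14 (i) (`PreFrobenioid.trichotomy_of_isIrreducibleHom`, which uses no base
hypothesis) EVERY irreducible morphism is a non-pre-step (a prime-Frobenius morphism or a pull-back
morphism with irreducible base). Consequently the class "irreducible morphisms which are not pre-steps"
of Prop. 1.14 (ii) is just "irreducible morphisms" — an intrinsic categorical notion — and Prop. 1.14 (ii)
("pre-step ⟺ FSM-morphism mid-adjoint to that class", `PreFrobenioid.isPreStep_iff_isFSM_and_isMidAdjoint`,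
which consumes only condition (a) of "FSMFF-type") transports along any equivalence:
* `FrdI.not_isPreStep_of_isIrreducibleHom_of_isOfPerfectType` — perfect + isotropic type: irreducible ⟹
  not a pre-step;
* `FrdI.isPreStep_map_of_isOfPerfectType` — `C₁` of perfect isotropic type, `C₂` of isotropic type over a
  base `D₂` of FSMFF-type AS PRINTED (2008; only (a) is used): `Ψ` maps pre-steps to pre-steps — NO
  hypothesis on `D₁`, no revision of (b);
* `FrdI.thm34ii_isotropic_of_isOfPerfectType` — all three clauses of Thm. 3.4 (ii) for Frobenioids of
  perfect isotropic type over bases of FSMFF-type (2008), i.e. the printed base hypothesis;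
* `FrdI.thm34ii_ofFunctor_of_isOfPerfectType` — the typed `PreFrobenioidData.Thm34ii` at `ofFunctor` for
  Frobenioids of perfect isotropic type, consuming the typed statement's OWN 2008 base antecedents.
This closes the "FSMFF-2008 ∖ FSMFF-2024" residual of the pre-step clause in the perfect isotropic case —
the case in which the cell's [FrdI] Thm. 4.2 / 4.9 chain works ("after passing to perfections",
`FrdI.T42.Setting`). No statement of the paper is strengthened (perfect ⊂ all; isotropic ⊂ quasi-isotropic);
no new definition; nothing here bears on [IUTchIII].
-/

namespace Literature.AlgebraicGeometry.Frobenioids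

open CategoryTheory Opposite

universe w v v' u u'

section Monoid

variable {M : Type w} [CommMonoid M]

/-- A perfect monoid (every `n`-th power map bijective, `n ≥ 1`) has no irreducible element: `a = r · r`
for the square root `r` of `a`, and `r = 1` forces `a = 1`. [cite: MochizukiFrdI2008, §0 p.11] -/
theorem IsPerfect.not_isIrreducibleElt (h : IsPerfect M) (a : M) : ¬ IsIrreducibleElt a := by
  rintro ⟨ha, hirr⟩
  obtain ⟨r, hr⟩ := (h.bijective_pow 2 (by norm_num)).2 a
  have hr' : a = r * r := by rw [← hr]; exact pow_two r
  rcases hirr r r hr' with h1 | h1 <;>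
  · rw [h1, mul_one] at hr'
    exact ha hr'

end Monoid

namespace FrdI

section One

variable {D : Type u} [Category.{v} D] {Φ : Dᵒᵖ ⥤ CommMonCat.{w}} {C : Type u'} [Category.{v'} C]
  {F : C ⥤ ElemFrobenioid Φ}

/-- **In a Frobenioid of perfect and isotropic type every irreducible morphism is a NON-pre-step**:
by the trichotomy of Prop. 1.14 (i) an irreducible morphism is a prime-Frobenius morphism (Frobenius
degree a prime `≠ 1`), a step with irreducible zero divisor (impossible: `Φ(A)` is perfect by
Prop. 1.10 (iii)), or a pull-back morphism with irreducible, hence non-invertible, base.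
[cite: MochizukiFrdI2008, Prop. 1.14(i) p.41] -/
theorem not_isPreStep_of_isIrreducibleHom_of_isOfPerfectType (hF : PreFrobenioid.IsFrobenioid F)
    (hist : PreFrobenioid.IsOfIsotropicType F) (hperf : PreFrobenioid.IsOfPerfectType F)
    {A B : C} {φ : A ⟶ B} (hφ : IsIrreducibleHom φ) : ¬ PreFrobenioid.IsPreStep F φ := by
  intro hps
  rcases PreFrobenioid.trichotomy_of_isIrreducibleHom F hF hist hφ with hπ | ⟨-, hirr⟩ | ⟨-, hb⟩
  · -- prime-Frobenius: `deg_Fr` prime, but a pre-step is linear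
    have h1 : (PreFrobenioid.degFr F φ : ℕ) = 1 := by
      rw [show PreFrobenioid.degFr F φ = 1 from hps.1]; rfl
    exact (Nat.Prime.one_lt hπ.2).ne' h1
  · -- step with irreducible zero divisor: none in a perfect monoid
    exact (PreFrobenioid.isPerfect_divisorMonoid hF hperf A).not_isIrreducibleElt _ hirr
  · -- pull-back morphism over an irreducible base arrow: not a base-isomorphism
    exact hb.1 hps.2

end One

section Two

variable {D₁ : Type u} [Category.{v} D₁] {Φ₁ : D₁ᵒᵖ ⥤ CommMonCat.{w}} {C₁ : Type u'}
  [Category.{v'} C₁] {D₂ : Type u} [Category.{v} D₂] {Φ₂ : D₂ᵒᵖ ⥤ CommMonCat.{w}} {C₂ : Type u'}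
  [Category.{v'} C₂] {F₁ : C₁ ⥤ ElemFrobenioid Φ₁} {F₂ : C₂ ⥤ ElemFrobenioid Φ₂}

/-- **Thm. 3.4 (ii), pre-steps, for `C₁` of PERFECT isotropic type — base hypothesis as printed in 2008
(and only on `D₂`, and only its condition (a))**: an equivalence `Ψ : C₁ ⥲ C₂` onto a Frobenioid of
isotropic type over a base of FSMFF-type maps pre-steps to pre-steps. Route: Prop. 1.14 (ii) in `C₁`
(necessity) and in `C₂` (sufficiency, condition (a) of `D₂`), transport of FSM-ness and of
mid-adjointness along `Ψ`; the class "irreducible non-pre-steps" pulls back along `Ψ⁻¹` because in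
`C₁` every irreducible morphism is a non-pre-step (perfect type) and irreducibility is intrinsic.
[cite: MochizukiFrdI2008, Thm. 3.4 (ii) p.63] -/
theorem isPreStep_map_of_isOfPerfectType (hF₁ : PreFrobenioid.IsFrobenioid F₁)
    (hF₂ : PreFrobenioid.IsFrobenioid F₂) (hist₁ : PreFrobenioid.IsOfIsotropicType F₁)
    (hist₂ : PreFrobenioid.IsOfIsotropicType F₂) (hperf₁ : PreFrobenioid.IsOfPerfectType F₁)
    (hD₂ : IsOfFSMFFType D₂) (Ψ : C₁ ≌ C₂) {A B : C₁} {φ : A ⟶ B}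
    (hφ : PreFrobenioid.IsPreStep F₁ φ) : PreFrobenioid.IsPreStep F₂ (Ψ.functor.map φ) := by
  obtain ⟨hfsm, hmid⟩ := hφ.isFSM_and_isMidAdjoint F₁ hF₁ hist₁
  refine PreFrobenioid.isPreStep_of_isFSM_isMidAdjoint F₂ hF₂ hist₂ hD₂ (hfsm.map_equivalence Ψ) ?_
  refine IsMidAdjoint.map_equivalence Ψ
    (S₁ := fun _ _ ψ => IsIrreducibleHom ψ ∧ ¬ PreFrobenioid.IsPreStep F₁ ψ)
    (S₂ := fun _ _ ψ => IsIrreducibleHom ψ ∧ ¬ PreFrobenioid.IsPreStep F₂ ψ) (fun X Y β hβ => ?_) hmid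
  have hβ₁ : IsIrreducibleHom (Ψ.inverse.map β) := hβ.1.map_equivalence Ψ.symm
  exact ⟨hβ₁, not_isPreStep_of_isIrreducibleHom_of_isOfPerfectType hF₁ hist₁ hperf₁ hβ₁⟩

set_option backward.isDefEq.respectTransparency false in
/-- With both Frobenioids of perfect isotropic type and both bases of FSMFF-type (2008), `Ψ` preserves AND
reflects pre-steps. [cite: MochizukiFrdI2008, Thm. 3.4 (ii) p.63] -/
theorem isPreStep_map_iff_of_isOfPerfectType (hF₁ : PreFrobenioid.IsFrobenioid F₁)
    (hF₂ : PreFrobenioid.IsFrobenioid F₂) (hist₁ : PreFrobenioid.IsOfIsotropicType F₁)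
    (hist₂ : PreFrobenioid.IsOfIsotropicType F₂) (hperf₁ : PreFrobenioid.IsOfPerfectType F₁)
    (hperf₂ : PreFrobenioid.IsOfPerfectType F₂) (hD₁ : IsOfFSMFFType D₁) (hD₂ : IsOfFSMFFType D₂)
    (Ψ : C₁ ≌ C₂) {A B : C₁} (φ : A ⟶ B) :
    PreFrobenioid.IsPreStep F₂ (Ψ.functor.map φ) ↔ PreFrobenioid.IsPreStep F₁ φ := by
  refine ⟨fun h => ?_, isPreStep_map_of_isOfPerfectType hF₁ hF₂ hist₁ hist₂ hperf₁ hD₂ Ψ⟩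
  have h1 := isPreStep_map_of_isOfPerfectType hF₂ hF₁ hist₂ hist₁ hperf₂ hD₁ Ψ.symm h
  have h2 : PreFrobenioid.IsPreStep F₁ (Ψ.unitInv.app A ≫ φ ≫ Ψ.unit.app B) := by
    have := h1
    rw [show Ψ.symm.functor.map (Ψ.functor.map φ) = Ψ.inverse.map (Ψ.functor.map φ) from rfl,
      Ψ.inv_fun_map] at this
    exact this
  have h3 : PreFrobenioid.IsPreStep F₁ (φ ≫ Ψ.unit.app B) := by
    have h4 := PreFrobenioid.IsPreStep.comp F₁ (PreFrobenioid.isPreStep_of_isIso F₁ (Ψ.unit.app A)) h2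
    rwa [Iso.hom_inv_id_app_assoc] at h4
  have h5 := PreFrobenioid.IsPreStep.comp F₁ h3 (PreFrobenioid.isPreStep_of_isIso F₁ (Ψ.unitInv.app B))
  simpa using h5

/-- **`Ψ` preserves group-like objects** — perfect isotropic type, bases of FSMFF-type (2008): the pre-step
core for `Ψ⁻¹` plus "group-like ⟺ every pre-step out of the object is invertible"
(`FrdI.isGroupLikeObj_iff_preSteps_isIso`, seat abc-iut-L1-t13). [cite: MochizukiFrdI2008, Thm. 3.4 (ii) p.62] -/
theorem isGroupLikeObj_map_of_isOfPerfectType (hF₁ : PreFrobenioid.IsFrobenioid F₁)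
    (hF₂ : PreFrobenioid.IsFrobenioid F₂) (hist₁ : PreFrobenioid.IsOfIsotropicType F₁)
    (hist₂ : PreFrobenioid.IsOfIsotropicType F₂) (hperf₂ : PreFrobenioid.IsOfPerfectType F₂)
    (hD₁ : IsOfFSMFFType D₁) (Ψ : C₁ ≌ C₂) {A : C₁} (hA : PreFrobenioid.IsGroupLikeObj F₁ A) :
    PreFrobenioid.IsGroupLikeObj F₂ (Ψ.functor.obj A) := by
  rw [isGroupLikeObj_iff_preSteps_isIso hF₂ hist₂]
  intro B' φ' hφ'
  have hρ : PreFrobenioid.IsPreStep F₁ (Ψ.inverse.map φ') :=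
    isPreStep_map_of_isOfPerfectType hF₂ hF₁ hist₂ hist₁ hperf₂ hD₁ Ψ.symm hφ'
  have h1 : PreFrobenioid.IsPreStep F₁ (Ψ.unit.app A ≫ Ψ.inverse.map φ') :=
    PreFrobenioid.IsPreStep.comp F₁ (PreFrobenioid.isPreStep_of_isIso F₁ _) hρ
  haveI : IsIso (Ψ.unit.app A ≫ Ψ.inverse.map φ') :=
    (isGroupLikeObj_iff_preSteps_isIso hF₁ hist₁ A).1 hA _ h1
  haveI : IsIso (Ψ.inverse.map φ') := IsIso.of_isIso_comp_left (Ψ.unit.app A) (Ψ.inverse.map φ')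
  exact isIso_of_fully_faithful Ψ.inverse φ'

/-- **[FrdI] Thm. 3.4 (ii) for Frobenioids of PERFECT isotropic type over bases of FSMFF-type AS PRINTED
(2008 condition (b))**: `Ψ` preserves pre-steps, co-angular pre-steps (automatic in isotropic type,
Prop. 1.4 (i)) and group-like objects. No revision of "FSMFF-type" is used.
[cite: MochizukiFrdI2008, Thm. 3.4 (ii) p.62] -/
theorem thm34ii_isotropic_of_isOfPerfectType (hF₁ : PreFrobenioid.IsFrobenioid F₁)
    (hF₂ : PreFrobenioid.IsFrobenioid F₂) (hist₁ : PreFrobenioid.IsOfIsotropicType F₁)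
    (hist₂ : PreFrobenioid.IsOfIsotropicType F₂) (hperf₁ : PreFrobenioid.IsOfPerfectType F₁)
    (hperf₂ : PreFrobenioid.IsOfPerfectType F₂) (hD₁ : IsOfFSMFFType D₁) (hD₂ : IsOfFSMFFType D₂)
    (Ψ : C₁ ≌ C₂) :
    (∀ ⦃A B : C₁⦄ (φ : A ⟶ B), PreFrobenioid.IsPreStep F₁ φ → PreFrobenioid.IsPreStep F₂ (Ψ.functor.map φ)) ∧
      (∀ ⦃A B : C₁⦄ (φ : A ⟶ B), PreFrobenioid.IsCoAngularPreStep F₁ φ →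
        PreFrobenioid.IsCoAngularPreStep F₂ (Ψ.functor.map φ)) ∧
      (∀ ⦃A : C₁⦄, PreFrobenioid.IsGroupLikeObj F₁ A → PreFrobenioid.IsGroupLikeObj F₂ (Ψ.functor.obj A)) :=
  ⟨fun _ _ _ hφ => isPreStep_map_of_isOfPerfectType hF₁ hF₂ hist₁ hist₂ hperf₁ hD₂ Ψ hφ,
    fun _ _ _ hφ => ⟨PreFrobenioid.isCoAngular_of_isIsotropic_codomains F₂ _ (fun Z _ => hist₂ Z),
      isPreStep_map_of_isOfPerfectType hF₁ hF₂ hist₁ hist₂ hperf₁ hD₂ Ψ hφ.2⟩,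
    fun _ hA => isGroupLikeObj_map_of_isOfPerfectType hF₁ hF₂ hist₁ hist₂ hperf₂ hD₁ Ψ hA⟩

/-- **The typed per-instance [FrdI] Thm. 3.4 (ii), `PreFrobenioidData.Thm34ii` (abc-iut-L1-t3), HOLDS for
every pair of Frobenioids of PERFECT and ISOTROPIC type and every equivalence `Ψ`** — the typed statement's
own 2008 base antecedents `IsOfFSMFFType D₁`, `IsOfFSMFFType D₂` are the ones consumed (its
quasi-isotropic antecedents are implied by, and here replaced by, the explicit isotropic hypotheses).
[cite: MochizukiFrdI2008, Thm. 3.4 (ii) p.62] -/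
theorem thm34ii_ofFunctor_of_isOfPerfectType (hF₁ : PreFrobenioid.IsFrobenioid F₁)
    (hF₂ : PreFrobenioid.IsFrobenioid F₂) (hist₁ : PreFrobenioid.IsOfIsotropicType F₁)
    (hist₂ : PreFrobenioid.IsOfIsotropicType F₂) (hperf₁ : PreFrobenioid.IsOfPerfectType F₁)
    (hperf₂ : PreFrobenioid.IsOfPerfectType F₂) (Ψ : C₁ ≌ C₂) :
    (PreFrobenioidData.ofFunctor Φ₁ F₁).Thm34ii (PreFrobenioidData.ofFunctor Φ₂ F₂) Ψ := by
  intro _ _ hD₁ hD₂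
  obtain ⟨h1, h2, h3⟩ := thm34ii_isotropic_of_isOfPerfectType hF₁ hF₂ hist₁ hist₂ hperf₁ hperf₂ hD₁ hD₂ Ψ
  refine ⟨fun A B φ hφ => h1 φ hφ, fun A B φ hφ => ?_, fun A hA => h3 hA⟩
  have h := h2 φ ⟨(PreFrobenioidData.ofFunctor_isCoAngular F₁ φ).1 hφ.1, hφ.2⟩
  exact ⟨(PreFrobenioidData.ofFunctor_isCoAngular F₂ _).2 h.1, h.2⟩

/-- The same for `Ψ⁻¹`. [cite: MochizukiFrdI2008, Thm. 3.4 (ii) p.62] -/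
theorem thm34ii_ofFunctor_symm_of_isOfPerfectType (hF₁ : PreFrobenioid.IsFrobenioid F₁)
    (hF₂ : PreFrobenioid.IsFrobenioid F₂) (hist₁ : PreFrobenioid.IsOfIsotropicType F₁)
    (hist₂ : PreFrobenioid.IsOfIsotropicType F₂) (hperf₁ : PreFrobenioid.IsOfPerfectType F₁)
    (hperf₂ : PreFrobenioid.IsOfPerfectType F₂) (Ψ : C₁ ≌ C₂) :
    (PreFrobenioidData.ofFunctor Φ₂ F₂).Thm34ii (PreFrobenioidData.ofFunctor Φ₁ F₁) Ψ.symm :=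
  thm34ii_ofFunctor_of_isOfPerfectType hF₂ hF₁ hist₂ hist₁ hperf₂ hperf₁ Ψ.symm

end Two

end FrdI

end Literature.AlgebraicGeometry.Frobenioids
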